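import Literature.NumberTheory.GaloisRepresentations.ContinuousCorestriction
import Literature.NumberTheory.GaloisRepresentations.AbsGaloisGroupCompact
import Literature.NumberTheory.GaloisRepresentations.GaloisCohomology
import HarnessLib

/-!
# Restriction of `H¹` to an intersection of open subgroups is injective when every finite stage is
# (compactness of `Γ_K`; theorems only)

`Proofs` file (no definition, no named fact, no instance, no `sorry`).  For a discrete `Γ_K`-module `M`
(`DiscreteGaloisModule K M`), a decreasing sequence of OPEN subgroups `U_N ≤ Γ_K` and a subgroup
`V ⊇ ⋂_N U_N`: if every restriction `H¹(Γ_K, M) → H¹(U_N, M)` is injective then so is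
`H¹(Γ_K, M) → H¹(V, M)` (`DiscreteGaloisModule.resSubgroup_one_eq_zero_of_iInf_le`).  Proof: a class dying
on `V` is represented by a continuous crossed homomorphism `φ` which is the coboundary of some `m` ON `V`; the
locus `{g | φ g = g•m - m}` is open (`M` discrete, orbit maps continuous) and contains `⋂_N U_N`, hence —
`Γ_K` being compact and the `U_N` closed — contains some `U_N` (Mathlib
`IsCompact.elim_directed_family_closed`); so the class dies on `U_N`, hence is `0`.

This is the compactness step turning the FINITE-LAYER form of Howard's hypothesis H.2 («`H¹(F(μ_{p^∞})/K,
T̄) = 0`», arXiv:1202.6340 p. 7 L61–63; in the tree as injectivity of `res` to every open normal `U ⊇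
Γ_{K(E[p^{m+1}])} ∩ Gal(K̄/K_∞)`, `HeegnerMuPartHowardH2.subgroupResKer_geomTorsion_eq_bot_of_thm413Hypotheses_ker`)
into the CLOSED-subgroup form that `Howard2004.AdicTower.H2Tower` asks for (`res` to
`Γ_F ⊓ ⋂_n ker μ_{p^n}` injective).  Cell `pub/bsd-print-x9`, v9 STUB 1, field `SatisfiesH.h2`; seat
`bsd-line-x10b-p1-w7` g0.  No summit statement is proved; BSD is not proved by any of this.

References: J.-P. Serre, *Galois Cohomology* (1997), I §2.2 Prop. 8 (`Hⁿ(lim G_i, A) = colim Hⁿ(G_i, A)` for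
discrete `A` — the same compactness), I §2.4; B. Howard, Compositio Math. 140 (2004), H.2 (arXiv:1202.6340
p. 7, L61–63).
-/

noncomputable section

open CategoryTheory

universe u

namespace Literature.NumberTheory.GaloisRepresentations

namespace DiscreteGaloisModule

variable {K : Type u} [Field K] {M : Type u} [AddCommGroup M] [TopologicalSpace M] [DiscreteTopology M]

/-- **A class of `H¹(Γ_K, M)` restricting to zero on a subgroup `H` restricts to zero on every subgroup
`H' ≤ Γ_K` contained in the locus where a representing cocycle is the coboundary found on `H`** — the
cocycle-level form of «`res_{H'} [φ] = 0`» used below. [cite: SerreGaloisCohomology1997, Ch. I §2.4 and §5.1] -/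
theorem resSubgroup_one_oneCocycleClass_eq_zero_of_subset (ρ : DiscreteGaloisModule K M)
    (φ : contOneCocycles ρ.toTopRep) (m : M) (H : Subgroup (Field.absoluteGaloisGroup K))
    (hH : (H : Set (Field.absoluteGaloisGroup K)) ⊆ {g | φ.1 g = ρ g m - m}) :
    (resSubgroup ρ.toTopRep H 1).hom (oneCocycleClass ρ.toTopRep φ) = 0 := by
  change resSubgroup ρ.toTopRep H 1 (oneCocycleClass ρ.toTopRep φ) = 0
  rw [resSubgroup_oneCocycleClass, oneCocycleClass_eq_zero_iff]
  exact ⟨m, fun g ↦ hH g.2⟩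

/-- **Restriction to (a subgroup containing) the intersection of a decreasing sequence of open subgroups is
injective on `H¹` as soon as restriction to every `U_N` is.**  `Γ_K` is compact and the `U_N` are closed,
so the open locus where a representing cocycle is a coboundary, which contains `V ⊇ ⋂_N U_N` when the
class dies on `V`, contains some `U_N`. [cite: SerreGaloisCohomology1997, Ch. I §2.2 Prop. 8 and §2.4]
[cite: Howard2004HeegnerKolyvagin, H.2 (arXiv p. 7, L61–63)] -/
theorem resSubgroup_one_eq_zero_of_iInf_le (ρ : DiscreteGaloisModule K M)
    (U : ℕ → Subgroup (Field.absoluteGaloisGroup K)) (hanti : Antitone U)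
    (hU : ∀ N, IsOpen (U N : Set (Field.absoluteGaloisGroup K)))
    (hinj : ∀ N (c : galoisCohomology ρ 1), (resSubgroup ρ.toTopRep (U N) 1).hom c = 0 → c = 0)
    (V : Subgroup (Field.absoluteGaloisGroup K)) (hV : ⨅ N, U N ≤ V)
    (c : galoisCohomology ρ 1) (hc : (resSubgroup ρ.toTopRep V 1).hom c = 0) : c = 0 := by
  haveI : CompactSpace (Field.absoluteGaloisGroup K) := absoluteGaloisGroup_compactSpace K
  obtain ⟨φ, rfl⟩ := oneCocycleClass_surjective ρ.toTopRep c
  change resSubgroup ρ.toTopRep V 1 (oneCocycleClass ρ.toTopRep φ) = 0 at hc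
  rw [resSubgroup_oneCocycleClass, oneCocycleClass_eq_zero_iff] at hc
  obtain ⟨m, hm⟩ := hc
  -- the open locus where `φ` is the coboundary of `m`
  set Z : Set (Field.absoluteGaloisGroup K) := {g | φ.1 g = ρ g m - m} with hZdef
  have hZ : IsOpen Z := by
    have hcont : Continuous fun g : Field.absoluteGaloisGroup K ↦ φ.1 g - (ρ g m - m) :=
      φ.1.continuous.sub ((ρ.continuous_apply_left m).sub continuous_const)
    have hZ' : Z = (fun g : Field.absoluteGaloisGroup K ↦ φ.1 g - (ρ g m - m)) ⁻¹' {0} := by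
      ext g
      simp only [hZdef, Set.mem_setOf_eq, Set.mem_preimage, Set.mem_singleton_iff, sub_eq_zero]
    rw [hZ']
    exact (isOpen_discrete _).preimage hcont
  have hVZ : ((⨅ N, U N : Subgroup (Field.absoluteGaloisGroup K)) : Set (Field.absoluteGaloisGroup K)) ⊆ Z :=
    fun g hg ↦ hm ⟨g, hV hg⟩
  -- compactness: some `U N` lies in `Z`
  obtain ⟨N, hN⟩ : ∃ N, (U N : Set (Field.absoluteGaloisGroup K)) ⊆ Z := by
    have hcpt : IsCompact Zᶜ := hZ.isClosed_compl.isCompact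
    have hdir : Directed (· ⊇ ·) (fun N ↦ (U N : Set (Field.absoluteGaloisGroup K))) :=
      Antitone.directed_ge (fun a b hab ↦ SetLike.coe_subset_coe.mpr (hanti hab))
    have hempty : Zᶜ ∩ ⋂ N, (U N : Set (Field.absoluteGaloisGroup K)) = ∅ := by
      rw [← Subgroup.coe_iInf, ← Set.disjoint_iff_inter_eq_empty]
      exact Set.disjoint_compl_left_iff_subset.mpr hVZ
    obtain ⟨N, hN⟩ := hcpt.elim_directed_family_closed _ (fun N ↦ (U N).isClosed_of_isOpen (hU N))
      hempty hdir
    exact ⟨N, Set.disjoint_compl_left_iff_subset.mp (Set.disjoint_iff_inter_eq_empty.mpr hN)⟩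
  exact hinj N _ (resSubgroup_one_oneCocycleClass_eq_zero_of_subset ρ φ m (U N) hN)

end DiscreteGaloisModule

end Literature.NumberTheory.GaloisRepresentations

end
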